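import Summits.CriticalPhenomena.SAWScalingLimit.Theorems.SAWLoopFugacityFlowSimpleSubseqLimitsTransferLattice
import HarnessLib

/-!
# Line `slit-continuous-restriction` — the open input needs only FIRST-ENTRANCE limit pasts
# (crux stmt-CriticalPhenomena-4982, decl
# `Summit.CriticalPhenomena.SAWScalingLimit.Theses.SAWLoopFugacityFlow.SimpleSubseqLimits`)

The open input `Transfer.SequentialSlitAvoidance` of the line quantifies over EVERY admissible limit past
`π` at the entrance ball `B̄(q, ρ)`. This file certifies that only **first-entrance** limit pasts matter:
along every sequence of lattice first-entrance prefixes (meshes `→ 0⁺`, tip vertex in `B̄(q, ρ)`, earlier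
vertices outside) whose classes converge to the class of an admissible `π`, the limit past necessarily
starts at the root `a = D.pt 0`, stays outside the OPEN ball `B(q, ρ)`, and has its tip ON the sphere
`dist (π 1) q = ρ` (`isFirstEntrancePast_of_tendsto`). Hence the input is EQUIVALENT to its restriction to
first-entrance pasts (`seqSlitAvoidance_iff_firstEntrance`): for a non-first-entrance `π` no qualifying
sequence exists and the bound holds vacuously. The planner may therefore file either form as the crux's
child item; the restricted form `SequentialSlitAvoidanceFE` is the natural one ("for every admissible
first-entrance past").
-/

noncomputable section

open MeasureTheory Filter Topology Set Metric Function
open Literature.Probability.RandomPlanarGeometry Literature.Probability.RandomPlanarGeometry.SAW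
open Literature.Probability.LatticeModels
open scoped ENNReal NNReal unitInterval

namespace Summit.CriticalPhenomena.SAWScalingLimit.Theorems.SimpleSubseqLimits.SlitRestriction.Transfer

open Summit.CriticalPhenomena.SAWScalingLimit.Theorems.SimpleSubseqLimits.MarkedPointRevisit.Passage
  (latticeCurve)
open Summit.CriticalPhenomena.SAWScalingLimit.Theorems.SimpleSubseqLimits.SlitRestriction.Lattice
  (prefixEvent approachEvent)
open Summit.CriticalPhenomena.SAWScalingLimit.Theorems.SimpleSubseqLimits.SlitRestriction.Arc
  (IsAdmissiblePast)
open Summit.CriticalPhenomena.SAWScalingLimit.Theorems.SimpleSubseqLimits.SlitRestriction.Timing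
  (vertexTime vertexTime_mono latticeCurve_vertexTime latticeCurve_one latticeCurve_of_vertexTime_length_le)

/-! ## Vocabulary -/

/-- **First-entrance limit past** at the ball `B̄(q, ρ)`: rooted at `a = D.pt 0`, never inside the OPEN
ball `B(q, ρ)`, tip on the sphere. (The form every limit of lattice first-entrance prefixes has.)
[folklore] -/
def IsFirstEntrancePast (D : DobrushinDomain) (π : Curve ℂ) (q : ℂ) (ρ : ℝ) : Prop :=
  π 0 = D.pt 0 ∧ (∀ u : I, ρ ≤ dist (π u) q) ∧ dist (π 1) q = ρ

/-- **SEQUENTIAL SLIT AVOIDANCE FOR FIRST-ENTRANCE PASTS**: the open input of the line restricted to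
admissible limit pasts that are first-entrance pasts (`IsFirstEntrancePast`). Equivalent to
`SequentialSlitAvoidance` (`seqSlitAvoidance_iff_firstEntrance`). (Auxiliary statement of line
slit-continuous-restriction of crux stmt-CriticalPhenomena-4982; research-open like the unrestricted
form; not a literature fact.) -/
def SequentialSlitAvoidanceFE : Prop :=
  ∀ (D : DobrushinDomain) (a b : ℝ → Site 2), SAW.IsEndpointApprox D a b →
    ∀ (π : Curve ℂ) (q : ℂ) (ρ R : ℝ), 0 < ρ → ρ < R → IsAdmissiblePast D π q ρ →
      IsFirstEntrancePast D π q ρ →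
      ∀ θ : ℝ, 0 < θ → ∃ ε : ℝ, 0 < ε ∧
        ∀ (s : ℕ → ℝ) (t : ℕ → Site 2) (ω : ∀ n : ℕ, SAW.DomainSAW D.carrier (s n) (a (s n)) (t n)),
          Tendsto s atTop (𝓝[>] (0 : ℝ)) →
          (∀ n : ℕ, meshPoint (s n) (t n) ∈ closedBall q ρ) →
          (∀ n : ℕ, ∀ x ∈ (ω n).walk.support.dropLast, meshPoint (s n) x ∉ closedBall q ρ) →
          Tendsto (fun n => (ω n).curve) atTop (𝓝 (CurveClass.mk π)) →
          ∀ᶠ n in atTop,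
            SAW.law D.carrier (s n) (a (s n)) (b (s n))
                (approachEvent (v := b (s n)) (ω n) (farPast π q R) ε) ≤
              ENNReal.ofReal θ *
                SAW.law D.carrier (s n) (a (s n)) (b (s n)) (prefixEvent (v := b (s n)) (ω n))

/-! ## Lattice facts about first-entrance prefixes -/

section Lattice

variable {Ω : Set ℂ} {δ : ℝ} {u v : Site 2}

/-- An interior vertex of a walk (index `< |ω|`) belongs to `support.dropLast`. [folklore] -/
theorem getVert_mem_dropLast {V : Type*} {G : SimpleGraph V} {u v : V} (ω : G.Walk u v) {j : ℕ}
    (hj : j < ω.length) : ω.getVert j ∈ ω.support.dropLast := by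
  rw [List.dropLast_eq_take, SimpleGraph.Walk.length_support, Nat.add_sub_cancel,
    SimpleGraph.Walk.getVert_eq_support_getElem _ hj.le]
  have hlen : j < (ω.support.take ω.length).length := by
    rw [List.length_take, SimpleGraph.Walk.length_support]; omega
  have h := List.getElem_mem hlen
  rwa [List.getElem_take] at h

/-- For a first-entrance prefix of POSITIVE length (earlier vertices outside `B̄(q, ρ)`), every vertex —
the tip included, which is one lattice edge away from an outside vertex — is more than `ρ - |δ|` from
`q`. [folklore] -/
theorem dist_getVert_gt (ω : SAW.DomainSAW Ω δ u v) {q : ℂ} {ρ : ℝ}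
    (hout : ∀ x ∈ ω.walk.support.dropLast, meshPoint δ x ∉ closedBall q ρ) (hlen : 1 ≤ ω.length)
    (j : ℕ) : ρ - |δ| < dist (meshPoint δ (ω.walk.getVert j)) q := by
  have habs : 0 ≤ |δ| := abs_nonneg δ
  rcases lt_or_ge j ω.walk.length with hj | hj
  · have h := hout _ (getVert_mem_dropLast ω.walk hj)
    rw [mem_closedBall, not_le] at h
    linarith
  · -- the vertex is the endpoint; compare with the previous vertex, which is outside
    rw [SimpleGraph.Walk.getVert_of_length_le _ hj]
    have hl : ω.walk.length - 1 < ω.walk.length := by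
      have : 1 ≤ ω.walk.length := hlen
      omega
    have hprev := hout _ (getVert_mem_dropLast ω.walk hl)
    rw [mem_closedBall, not_le] at hprev
    have hadj : (zdGraph 2).Adj (ω.walk.getVert (ω.walk.length - 1))
        (ω.walk.getVert (ω.walk.length - 1 + 1)) :=
      meshGraph_le_zdGraph Ω δ (discreteDomainGraph_le_meshGraph Ω δ (ω.walk.adj_getVert_succ hl))
    have hsucc : ω.walk.length - 1 + 1 = ω.walk.length := by
      have : 1 ≤ ω.walk.length := hlen
      omega
    rw [hsucc, SimpleGraph.Walk.getVert_length] at hadj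
    have hd := Literature.Probability.Percolation.dist_meshPoint_of_adj (δ := δ) hadj
    have htri := dist_triangle (meshPoint δ (ω.walk.getVert (ω.walk.length - 1))) (meshPoint δ v) q
    linarith

/-- Every point of the mesh polyline of a first-entrance prefix of positive length is more than
`ρ - 2|δ|` from `q` (it is within `|δ|` of a vertex). [folklore] -/
theorem dist_latticeCurve_gt (hδ : 0 < δ) (ω : SAW.DomainSAW Ω δ u v) {q : ℂ} {ρ : ℝ}
    (hout : ∀ x ∈ ω.walk.support.dropLast, meshPoint δ x ∉ closedBall q ρ) (hlen : 1 ≤ ω.length)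
    (w : I) : ρ - 2 * δ < dist (latticeCurve ω w) q := by
  have h0 : vertexTime 0 ≤ w := Subtype.coe_le_coe.1 (by change (1 : ℝ) - (1 / 2) ^ 0 ≤ w; simpa using w.2.1)
  obtain ⟨j, -, -, hj⟩ := exists_vertex_near hδ ω (Nat.zero_le _) h0
  have hv := dist_getVert_gt ω hout hlen j
  rw [abs_of_pos hδ] at hv
  have htri := dist_triangle (meshPoint δ (ω.walk.getVert j)) (latticeCurve ω w) q
  linarith

/-- The mesh polyline of a prefix of length `0` is constant at its root. [folklore] -/
theorem latticeCurve_of_length_eq_zero (ω : SAW.DomainSAW Ω δ u v) (h : ω.length = 0) (w : I) :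
    latticeCurve ω w = meshPoint δ v := by
  refine latticeCurve_of_vertexTime_length_le ω ?_
  have h' : ω.walk.length = 0 := h
  rw [h']
  exact Subtype.coe_le_coe.1 (by change (1 : ℝ) - (1 / 2) ^ 0 ≤ w; simpa using w.2.1)

end Lattice

/-! ## Limits of first-entrance prefixes are first-entrance pasts -/

/-- Pointwise closeness of a converging sequence of classes: if `mk (L n) → mk π` then for every `κ > 0`,
eventually some reparametrisation puts `L n` uniformly `κ`-close to `π`. [folklore] -/
theorem eventually_exists_reparam_close {L : ℕ → Curve ℂ} {π : Curve ℂ}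
    (h : Tendsto (fun n => CurveClass.mk (L n)) atTop (𝓝 (CurveClass.mk π))) {κ : ℝ} (hκ : 0 < κ) :
    ∀ᶠ n in atTop, ∃ φ : I ≃o I, ∀ w : I, dist (π w) (L n (φ w)) < κ := by
  have hd : Tendsto (fun n => dist (CurveClass.mk π) (CurveClass.mk (L n))) atTop (𝓝 0) := by
    have := (tendsto_iff_dist_tendsto_zero.1 h)
    simpa only [dist_comm] using this
  filter_upwards [(tendsto_order.1 hd).2 κ hκ] with n hn
  rw [CurveClass.dist_mk_mk] at hn
  obtain ⟨φ, hφ⟩ := Curve.exists_dist_reparam_lt hn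
  refine ⟨φ, fun w => ?_⟩
  have h' := ContinuousMap.dist_apply_le_dist (f := π.toContinuousMap)
    (g := ((L n).reparam φ).toContinuousMap) (x := w)
  simp only [Curve.coe_toContinuousMap, Curve.reparam_apply] at h'
  exact h'.trans_lt hφ

/-- **Limits of lattice first-entrance prefixes are first-entrance pasts.** Along meshes `s n → 0⁺`,
first-entrance prefixes `ω n : a_{s n} → t n` into `B̄(q, ρ)` whose classes converge to the class of an
ADMISSIBLE `π` force `π 0 = D.pt 0` (sources converge), `range π ⊆ B(q, ρ)ᶜ` (polyline points are within
`2 s n` of the outside) and `dist (π 1) q = ρ` (tips converge; the tip vertex is in the closed ball and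
one edge from the outside). Admissibility is used only to make the prefixes eventually non-trivial.
[folklore] -/
theorem isFirstEntrancePast_of_tendsto {D : DobrushinDomain} {a : ℝ → Site 2}
    (ha : Tendsto (fun δ => meshPoint δ (a δ)) (𝓝[>] (0 : ℝ)) (𝓝 (D.pt 0)))
    {π : Curve ℂ} {q : ℂ} {ρ : ℝ} (hadm : IsAdmissiblePast D π q ρ)
    {s : ℕ → ℝ} {t : ℕ → Site 2} (ω : ∀ n : ℕ, SAW.DomainSAW D.carrier (s n) (a (s n)) (t n))
    (hs : Tendsto s atTop (𝓝[>] (0 : ℝ)))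
    (htip : ∀ n : ℕ, meshPoint (s n) (t n) ∈ closedBall q ρ)
    (hout : ∀ n : ℕ, ∀ x ∈ (ω n).walk.support.dropLast, meshPoint (s n) x ∉ closedBall q ρ)
    (hcv : Tendsto (fun n => (ω n).curve) atTop (𝓝 (CurveClass.mk π))) :
    IsFirstEntrancePast D π q ρ := by
  have hs0 : Tendsto s atTop (𝓝 0) := tendsto_nhdsWithin_iff.1 hs |>.1
  have hspos : ∀ᶠ n in atTop, 0 < s n := (tendsto_nhdsWithin_iff.1 hs).2
  have hcv' : Tendsto (fun n => CurveClass.mk (latticeCurve (ω n))) atTop (𝓝 (CurveClass.mk π)) := hcv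
  -- (1) the root
  have hsrc : π 0 = D.pt 0 := by
    have h₁ : Tendsto (fun n => ((ω n).curve).source) atTop (𝓝 (CurveClass.mk π).source) :=
      (CurveClass.continuous_source.tendsto _).comp hcv
    have h₂ : Tendsto (fun n => ((ω n).curve).source) atTop (𝓝 (D.pt 0)) := by
      have := ha.comp hs
      refine this.congr fun n => ?_
      change meshPoint (s n) (a (s n)) = (CurveClass.mk (latticeCurve (ω n))).source
      rw [CurveClass.source_mk, Curve.source_def]
      exact ((ω n).walk.toCurve_apply_zero (meshPoint (s n))).symm
    have := tendsto_nhds_unique h₁ h₂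
    rwa [CurveClass.source_mk, Curve.source_def] at this
  -- admissibility gives two distinct points of the range, hence the prefixes are eventually non-trivial
  obtain ⟨-, -, e, he, hrange, -, -⟩ := hadm
  have hne : e 0 ≠ e 1 := fun h => absurd (he h) (by norm_num)
  obtain ⟨u₀, hu₀⟩ : ∃ u₀ : I, e 0 = π u₀ := by
    have : e 0 ∈ Set.range (fun u : I => π u) := hrange ▸ ⟨0, rfl⟩
    obtain ⟨u₀, h⟩ := this; exact ⟨u₀, h.symm⟩
  obtain ⟨u₁, hu₁⟩ : ∃ u₁ : I, e 1 = π u₁ := by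
    have : e 1 ∈ Set.range (fun u : I => π u) := hrange ▸ ⟨1, rfl⟩
    obtain ⟨u₁, h⟩ := this; exact ⟨u₁, h.symm⟩
  have hD : 0 < dist (π u₀) (π u₁) := dist_pos.2 (by rw [← hu₀, ← hu₁]; exact hne)
  have hlen : ∀ᶠ n in atTop, 1 ≤ (ω n).length := by
    filter_upwards [eventually_exists_reparam_close hcv' (half_pos hD)] with n ⟨φ, hφ⟩
    by_contra h0
    have h0' : (ω n).length = 0 := by omega
    have hc : ∀ w : I, latticeCurve (ω n) w = meshPoint (s n) (t n) :=
      latticeCurve_of_length_eq_zero (ω n) h0'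
    have h₁ := hφ u₀
    have h₂ := hφ u₁
    rw [hc] at h₁ h₂
    have := dist_triangle (π u₀) (meshPoint (s n) (t n)) (π u₁)
    rw [dist_comm (meshPoint (s n) (t n))] at this
    linarith
  -- (2) every point of `π` is at distance `≥ ρ` from `q`
  have hfar : ∀ u : I, ρ ≤ dist (π u) q := by
    intro u
    refine le_of_forall_pos_lt_add fun κ hκ => ?_
    have hκ3 : 0 < κ / 3 := by positivity
    obtain ⟨n, ⟨φ, hφ⟩, hn1, hsn, hsnpos⟩ := ((eventually_exists_reparam_close hcv' hκ3).and
      (hlen.and (((tendsto_order.1 hs0).2 _ hκ3).and hspos))).exists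
    have h₁ := dist_latticeCurve_gt hsnpos (ω n) (hout n) hn1 (φ u)
    have h₂ := hφ u
    have h₃ := dist_triangle (latticeCurve (ω n) (φ u)) (π u) q
    rw [dist_comm] at h₂
    linarith
  -- (3) the tip is in the closed ball
  have htip' : dist (π 1) q ≤ ρ := by
    have h₁ : Tendsto (fun n => ((ω n).curve).target) atTop (𝓝 (CurveClass.mk π).target) :=
      (CurveClass.continuous_target.tendsto _).comp hcv
    rw [CurveClass.target_mk, Curve.target_def] at h₁
    have h₂ : ∀ n, ((ω n).curve).target = meshPoint (s n) (t n) := fun n => by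
      change (CurveClass.mk (latticeCurve (ω n))).target = _
      rw [CurveClass.target_mk, Curve.target_def]
      exact latticeCurve_one (ω n)
    have h₃ : Tendsto (fun n => dist (meshPoint (s n) (t n)) q) atTop (𝓝 (dist (π 1) q)) := by
      have := (h₁.dist (tendsto_const_nhds (x := q)))
      exact this.congr fun n => by rw [h₂]
    exact le_of_tendsto' h₃ fun n => mem_closedBall.1 (htip n)
  exact ⟨hsrc, hfar, le_antisymm htip' (hfar 1)⟩

/-! ## The equivalence -/

/-- **The open input needs only first-entrance pasts** (registered stub
`seqSlitAvoidance_iff_firstEntrance` of crux stmt-CriticalPhenomena-4982): `SequentialSlitAvoidance` is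
EQUIVALENT to its restriction to admissible FIRST-ENTRANCE limit pasts — for any other admissible `π` no
sequence of lattice first-entrance prefixes converges to `mk π` (`isFirstEntrancePast_of_tendsto`), so the
bound holds vacuously (with `ε = 1`). [folklore] -/
theorem seqSlitAvoidance_iff_firstEntrance : SequentialSlitAvoidance ↔ SequentialSlitAvoidanceFE := by
  constructor
  · intro h D a b hab π q ρ R hρ hρR hadm _ θ hθ
    exact h D a b hab π q ρ R hρ hρR hadm θ hθ
  · intro h D a b hab π q ρ R hρ hρR hadm θ hθ
    by_cases hFE : IsFirstEntrancePast D π q ρ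
    · exact h D a b hab π q ρ R hρ hρR hadm hFE θ hθ
    · refine ⟨1, one_pos, fun s t ω hs htip hout hcv => ?_⟩
      exact absurd (isFirstEntrancePast_of_tendsto hab.tendsto_fst hadm ω hs htip hout hcv) hFE

end Summit.CriticalPhenomena.SAWScalingLimit.Theorems.SimpleSubseqLimits.SlitRestriction.Transfer

end
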